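import Summits.Ventures.GridStability.Models.Chiang3
import Literature.MathematicalPhysics.PowerSystems.LosslessMultimachineDichotomy
import Literature.Analysis.ODE.LipschitzFlow
import HarnessLib

/-!
# GridStability/Models/InfBusLosslessDichotomy — model-1's `n`-machine–INFINITE-BUS classical model
# (`RecastData.IsInfBusSolutionOn`, node `0` = the bus) AS lit-6's `LosslessSystem n 1`, and ★ #93 WITH
# an infinite bus read BY NAME on it: along every infinite-bus motion EITHER the energy `→ −∞` with the
# injections' work `→ +∞` (loss of synchronism WITH the bus) OR the motion is quasi-static (all machine
# speed deviations and all power mismatches `→ 0`); bounded machine angles force the second branch;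
# instance CHIANG3 (Chiang's three-bus cycle, 2 machines + bus)

Venture GRIDFUSION (LADDER-GRIDFUSION G3 model row → G1.a′/G2), cell `run/shared/lean/pub/gridfusion/`,
seat gridfusion-model-1 (g7), default work «CS-INFBUS-DICHOTOMY» (companion of
`Models/ClassicalSwingLosslessDichotomy.lean`, p544815, which treats the ISOLATED network `m = 0`). THE
GAP: model-1's infinite-bus reading (`Models/PolynomialiseInfBus.lean` p464881: `RecastData n`, node `0` =
bus frozen at angle `δ₀` with speed deviation `0`, machines `1 … n` follow `toModel.field`) had no bridge to
lit-6's record `ClassicalModel.LosslessSystem n 1` (`n` machines, ONE bus of constant angle), on which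
lit-1 proved ★ #93 (`LosslessMultimachineDichotomy.lean` p530029/p533795 §5, §11) and §9 well-posedness.
NO new analysis here: every limit statement is lit-1's theorem through the bridge.

CONTENTS (`d : RecastData n`, lossless = `G_ij = 0` off the diagonal):
* `InfBus.machineProj` / `InfBus.busLift δ₀` (drop / re-insert the bus node); `RecastData.toLosslessInf d δ₀ :
  LosslessSystem n 1` (machines `i.succ`: `M`, `D`, `P′_i = Pprime_i − E_i²G_ii`, couplings `Cc` off the
  diagonal, bus couplings `K_i = Cc_{i,0}`, bus angle `δ₀`); `toLosslessInf_flow` (bus at `δ₀`: lit-6's flow =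
  model-1's `P_e,i.succ(δ) − E²G`); `hasDerivWithinAt_machineProj` / `isInfBusSolutionOn_busLift` — infinite-bus
  solutions of model-1 and solutions of lit-6's field correspond (project / lift, same time set);
* `exists_isInfBusSolutionOn_univ` (from EVERY admissible state a GLOBAL infinite-bus motion: lit-1 §9's
  Lipschitz field + `ODE.exists_solution_real_of_lipschitz`); `isInfBusSolutionOn_eq_of_eq_zero` (uniqueness);
* THE SENTENCES (`M_i, D_i > 0` on the machines, `B` reciprocal, lossless), along every infinite-bus
  solution on `[0, ∞)`: `infBus_dichotomy` (★ #93 §5: EITHER lit-6's energy `→ −∞` and `Σ_i P′_iδ_i → +∞`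
  OR the energy converges, every machine `ω_i → 0` and every mismatch `Pprime_i − P_e,i(δ(t)) → 0`),
  `infBus_quasistatic_of_angles_bounded` (★ #93 §11: bounded machine angles ⇒ the second branch);
* INSTANCE `Chiang3.data` (★ G1.a′ object, p464911): `Chiang3.infBus_dichotomy`,
  `Chiang3.infBus_quasistatic_of_angles_bounded`, `Chiang3.exists_infBus_motion` — hypothesis-free but
  for the solution / the state (data side conditions by `decide`).

THREE COLUMNS (never merged). CERTIFIED (kernel, standard axioms): statements about MODEL `M_cl`+bus =
model-1's `n`-machine–infinite-bus classical model with transfer conductances NEGLECTED (MODEL-VALIDITY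
MV-2L + the infinite-bus idealisation of MV-1 (bus of constant angle); CHIANG3: MV-2L+MV-P, REDEFINED injections
at the A1 circle points), CLASS = all admissible states. VALIDATED: nothing here. MODELLED: ★ #93's words —
`D_i > 0` load-bearing; with a bus the energy alternative (a) IS loss of synchronism with the bus; which
alternative holds from a given state is NOT claimed; convergence to ONE equilibrium point needs isolated
equilibria (lit-1 §6/§11, not instantiated here); nothing here says a grid is stable. Two bookkeeping
definitions (`machineProj`, `busLift`) + the reading `toLosslessInf`; no named fact; no `sorry`; no kit.
-/

noncomputable section

open Real Set Filter Finset
open scoped Topology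
open Literature.MathematicalPhysics.PowerSystems.ClassicalModel

namespace Summit.Ventures.GridStability.Models

/-! ### Dropping and re-inserting the bus node -/

namespace InfBus

variable {n : ℕ}

/-- The machine part of a state of the `(n+1)`-node model: drop node `0` (the bus).
[cite: SauerPai1998, §9.5 (infinite bus = machine of fixed angle)] -/
def machineProj (x : ClassicalSwing.State (n + 1)) : (Fin n → ℝ) × (Fin n → ℝ) :=
  (fun i => x.1 i.succ, fun i => x.2 i.succ)

/-- Re-insert the bus at angle `δ₀` with speed deviation `0`. [cite: SauerPai1998, §9.5] -/
def busLift (δ₀ : ℝ) (y : (Fin n → ℝ) × (Fin n → ℝ)) : ClassicalSwing.State (n + 1) :=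
  (Fin.cases δ₀ y.1, Fin.cases 0 y.2)

/-- Machine angles of the projection. [folklore] -/
@[simp] theorem machineProj_fst (x : ClassicalSwing.State (n + 1)) (i : Fin n) : (machineProj x).1 i = x.1 i.succ := rfl

/-- Machine speeds of the projection. [folklore] -/
@[simp] theorem machineProj_snd (x : ClassicalSwing.State (n + 1)) (i : Fin n) : (machineProj x).2 i = x.2 i.succ := rfl

/-- The lift has bus angle `δ₀`. [folklore] -/
@[simp] theorem busLift_fst_zero (δ₀ : ℝ) (y : (Fin n → ℝ) × (Fin n → ℝ)) : (busLift δ₀ y).1 0 = δ₀ := rfl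
/-- The lift has bus speed deviation `0`. [folklore] -/
@[simp] theorem busLift_snd_zero (δ₀ : ℝ) (y : (Fin n → ℝ) × (Fin n → ℝ)) : (busLift δ₀ y).2 0 = 0 := rfl

/-- Machine angles of the lift. [folklore] -/
@[simp] theorem busLift_fst_succ (δ₀ : ℝ) (y : (Fin n → ℝ) × (Fin n → ℝ)) (i : Fin n) : (busLift δ₀ y).1 i.succ = y.1 i := rfl
/-- Machine speeds of the lift. [folklore] -/
@[simp] theorem busLift_snd_succ (δ₀ : ℝ) (y : (Fin n → ℝ) × (Fin n → ℝ)) (i : Fin n) : (busLift δ₀ y).2 i.succ = y.2 i := rfl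

/-- `machineProj ∘ busLift δ₀ = id`. [folklore] -/
@[simp] theorem machineProj_busLift (δ₀ : ℝ) (y : (Fin n → ℝ) × (Fin n → ℝ)) : machineProj (busLift δ₀ y) = y := rfl

/-- A state whose bus sits at `(δ₀, 0)` is the lift of its machine part. [folklore] -/
theorem busLift_machineProj {δ₀ : ℝ} {x : ClassicalSwing.State (n + 1)} (h1 : x.1 0 = δ₀)
    (h2 : x.2 0 = 0) : busLift δ₀ (machineProj x) = x := by
  refine Prod.ext (funext fun i => ?_) (funext fun i => ?_)
  · refine Fin.cases ?_ (fun j => ?_) i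
    · simp [h1]
    · simp
  · refine Fin.cases ?_ (fun j => ?_) i
    · simp [h2]
    · simp

end InfBus

namespace RecastData

open InfBus

variable {n : ℕ} (d : RecastData n)

/-! ### The reading: `n` machines and ONE bus of constant angle -/

/-- **model-1's `n`-machine–infinite-bus model AS lit-6's `LosslessSystem n 1`.** Machine `i` of the record
is node `i.succ` of `d`: inertias `M`, dampings `D`, net powers `P′_i = Pprime_i − E_i²G_ii`, machine–machine
couplings `C_ij = Cc_{i.succ, j.succ}` (`= E_iE_jB_ij`) off the diagonal and `0` on it, machine–bus couplings
`K_i = Cc_{i.succ, 0}`, the one bus at angle `δ₀`. Bookkeeping: the same numbers.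
[cite: SauerPai1998, §9.5 (infinite-bus remark after (9.20)); VuTuritsyn2016, §II eq. (1)] -/
def toLosslessInf (δ₀ : ℝ) : LosslessSystem n 1 where
  M := fun i => d.M i.succ
  D := fun i => d.D i.succ
  P := fun i => d.Pprime i.succ - d.E i.succ ^ 2 * d.G i.succ i.succ
  C := fun i j => if i = j then 0 else d.Cc i.succ j.succ
  K := fun i _ => d.Cc i.succ 0
  β := fun _ => δ₀

/-- Machine–machine couplings of the reading are symmetric for reciprocal `B` (hypothesis `hC` of ★ #93).
[cite: SauerPai1998, §7.9.3 eq. (7.213)] -/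
theorem toLosslessInf_C_symm (hB : ∀ i j, d.B i j = d.B j i) (δ₀ : ℝ) :
    ∀ i j, (d.toLosslessInf δ₀).C i j = (d.toLosslessInf δ₀).C j i := by
  intro i j
  simp only [toLosslessInf]
  by_cases h : i = j
  · subst h; rfl
  · rw [if_neg h, if_neg (Ne.symm h)]
    simp only [Cc, hB i.succ j.succ]
    push_cast
    ring

/-- `toModel`'s coupling `C_ab` is the cast of the rational `Cc_ab`. [cite: SauerPai1998, §7.9.3 eq. (7.213)] -/
theorem toModel_Ccoef (a b : Fin (n + 1)) : d.toModel.Ccoef a b = ((d.Cc a b : ℚ) : ℝ) := by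
  simp only [ClassicalSwing.Ccoef, toModel, Cc]
  push_cast
  ring

/-- `toModel`'s transfer-conductance coupling vanishes off the diagonal for lossless data.
[cite: SauerPai1998, §7.9.3 eq. (7.214)] -/
theorem toModel_Dcoef_eq_zero (hG : ∀ i j, i ≠ j → d.G i j = 0) {a b : Fin (n + 1)} (hab : a ≠ b) :
    d.toModel.Dcoef a b = 0 := by
  simp [ClassicalSwing.Dcoef, toModel, hG a b hab]

/-- **Lossless flows agree (bus at `δ₀`).** On a state with bus angle `δ₀`, lit-6's flow of machine `i`,
`Σ_j C_ij sin(δ_i − δ_j) + K_i sin(δ_i − δ₀)`, is model-1's `P_e,i.succ(δ) − E²G` of `toModel`.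
[cite: SauerPai1998, §7.9.3 eq. (7.212), §9.5; VuTuritsyn2016, §II eq. (1)] -/
theorem toLosslessInf_flow (hG : ∀ i j, i ≠ j → d.G i j = 0) {δ₀ : ℝ} {x : ClassicalSwing.State (n + 1)}
    (h0 : x.1 0 = δ₀) (i : Fin n) :
    (d.toLosslessInf δ₀).flow (machineProj x).1 i =
      d.toModel.Pe x.1 i.succ - (d.E i.succ : ℝ) ^ 2 * (d.G i.succ i.succ : ℝ) := by
  classical
  have hPe : d.toModel.Pe x.1 i.succ - (d.E i.succ : ℝ) ^ 2 * (d.G i.succ i.succ : ℝ) =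
      ∑ j, (if i.succ = j then 0 else ((d.Cc i.succ j : ℚ) : ℝ) * sin (x.1 i.succ - x.1 j)) := by
    have h1 : d.toModel.Pe x.1 i.succ - (d.E i.succ : ℝ) ^ 2 * (d.G i.succ i.succ : ℝ) =
        ∑ j ∈ univ.erase i.succ, ((d.Cc i.succ j : ℚ) : ℝ) * sin (x.1 i.succ - x.1 j) := by
      unfold ClassicalSwing.Pe
      have hE : d.toModel.E i.succ ^ 2 * d.toModel.G i.succ i.succ =
          (d.E i.succ : ℝ) ^ 2 * (d.G i.succ i.succ : ℝ) := by simp [toModel]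
      rw [hE, add_sub_cancel_left]
      refine Finset.sum_congr rfl fun j hj => ?_
      rw [d.toModel_Dcoef_eq_zero hG (Finset.ne_of_mem_erase hj).symm, d.toModel_Ccoef]
      ring
    rw [h1, ← Finset.add_sum_erase univ _ (mem_univ i.succ), if_pos rfl, zero_add]
    exact Finset.sum_congr rfl fun j hj => by rw [if_neg (Finset.ne_of_mem_erase hj).symm]
  rw [hPe, Fin.sum_univ_succ, if_neg (Fin.succ_ne_zero i), h0]
  simp only [LosslessSystem.flow, toLosslessInf, machineProj_fst, Fin.succ_inj, Fin.sum_univ_one, ite_mul,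
    zero_mul]
  ring

/-- **Every infinite-bus solution of model-1 projects to a solution of lit-6's field** (lossless data;
same time set, same convention). [cite: SauerPai1998, §7.9.3 eqs. (7.215)–(7.216), §9.5; VuTuritsyn2016, §II eq. (1)] -/
theorem hasDerivWithinAt_machineProj (hG : ∀ i j, i ≠ j → d.G i j = 0) {δ₀ : ℝ}
    {c : ℝ → ClassicalSwing.State (n + 1)} {s : Set ℝ} (hc : d.IsInfBusSolutionOn δ₀ c s) :
    ∀ t ∈ s, HasDerivWithinAt (fun τ => machineProj (c τ))
      ((d.toLosslessInf δ₀).field (machineProj (c t))) s t := by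
  intro t ht
  obtain ⟨h0, _, hmach⟩ := hc t ht
  refine HasDerivWithinAt.prodMk ?_ ?_
  · rw [hasDerivWithinAt_pi]
    intro i
    exact (hmach i.succ (Fin.succ_ne_zero i)).1
  · rw [hasDerivWithinAt_pi]
    intro i
    have h := (hmach i.succ (Fin.succ_ne_zero i)).2
    have heq : ((d.toLosslessInf δ₀).P i - (d.toLosslessInf δ₀).D i * (machineProj (c t)).2 i -
          (d.toLosslessInf δ₀).flow (machineProj (c t)).1 i) / (d.toLosslessInf δ₀).M i =
        (d.toModel.field (c t)).2 i.succ := by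
      show _ = (d.toModel.P i.succ - d.toModel.Pe (c t).1 i.succ - d.toModel.D i.succ * (c t).2 i.succ) /
          d.toModel.M i.succ
      rw [d.toLosslessInf_flow hG h0]
      simp only [toLosslessInf, toModel, machineProj_snd]
      ring
    rw [heq]
    exact h

/-- **Conversely, every solution of lit-6's field lifts to an infinite-bus solution of model-1** (bus
re-inserted at `(δ₀, 0)`). [cite: SauerPai1998, §7.9.3 eqs. (7.215)–(7.216), §9.5] -/
theorem isInfBusSolutionOn_busLift (hG : ∀ i j, i ≠ j → d.G i j = 0) (δ₀ : ℝ)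
    {X : ℝ → (Fin n → ℝ) × (Fin n → ℝ)} {s : Set ℝ}
    (hX : ∀ t ∈ s, HasDerivWithinAt X ((d.toLosslessInf δ₀).field (X t)) s t) :
    d.IsInfBusSolutionOn δ₀ (fun τ => busLift δ₀ (X τ)) s := by
  intro t ht
  refine ⟨rfl, rfl, fun i hi => ?_⟩
  obtain ⟨j, rfl⟩ := Fin.exists_succ_eq.2 hi
  have h1 := (hasDerivWithinAt_pi.1 (hX t ht).hasFDerivWithinAt.fst.hasDerivWithinAt) j
  have h2 := (hasDerivWithinAt_pi.1 (hX t ht).hasFDerivWithinAt.snd.hasDerivWithinAt) j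
  refine ⟨?_, ?_⟩
  · simpa [LosslessSystem.field] using h1
  · have heq : ((d.toLosslessInf δ₀).field (X t)).2 j = (d.toModel.field (busLift δ₀ (X t))).2 j.succ := by
      show ((d.toLosslessInf δ₀).P j - (d.toLosslessInf δ₀).D j * (X t).2 j -
          (d.toLosslessInf δ₀).flow (X t).1 j) / (d.toLosslessInf δ₀).M j =
        (d.toModel.P j.succ - d.toModel.Pe (busLift δ₀ (X t)).1 j.succ -
          d.toModel.D j.succ * (busLift δ₀ (X t)).2 j.succ) / d.toModel.M j.succ
      have hf := d.toLosslessInf_flow hG (x := busLift δ₀ (X t)) (busLift_fst_zero δ₀ (X t)) j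
      rw [machineProj_busLift] at hf
      rw [hf]
      simp only [toLosslessInf, toModel, busLift_snd_succ]
      ring
    have h2' : HasDerivWithinAt (fun τ => (X τ).2 j) (((d.toLosslessInf δ₀).field (X t)).2 j) s t := by
      simpa using h2
    simpa [heq] using h2'

/-! ### Well-posedness transported (lit-1 §9) -/

/-- **From EVERY admissible state a GLOBAL infinite-bus motion exists** (bus at `(δ₀, 0)`; lossless data):
the lifted integral curve of lit-6's globally Lipschitz field (lit-1 `lipschitzWith_field` +
`Literature.Analysis.ODE.exists_solution_real_of_lipschitz`). [cite: Teschl2012, Thm. 2.2 and Cor. 2.6; VuTuritsyn2016, §II eq. (1)] -/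
theorem exists_isInfBusSolutionOn_univ (hG : ∀ i j, i ≠ j → d.G i j = 0) {δ₀ : ℝ}
    {x₀ : ClassicalSwing.State (n + 1)} (h1 : x₀.1 0 = δ₀) (h2 : x₀.2 0 = 0) :
    ∃ c : ℝ → ClassicalSwing.State (n + 1), c 0 = x₀ ∧ d.IsInfBusSolutionOn δ₀ c univ := by
  obtain ⟨X, hX0, hX⟩ := Literature.Analysis.ODE.exists_solution_real_of_lipschitz
    (d.toLosslessInf δ₀).lipschitzWith_field (machineProj x₀)
  refine ⟨fun τ => busLift δ₀ (X τ), ?_, d.isInfBusSolutionOn_busLift hG δ₀ fun t _ =>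
    (hX t).hasDerivWithinAt⟩
  show busLift δ₀ (X 0) = x₀
  rw [hX0, busLift_machineProj h1 h2]

/-- **Forward uniqueness**: two infinite-bus solutions on `[0, ∞)` with the same initial state agree at
every `t ≥ 0` (lit-1 `globalSolution_unique` on the projections; the bus components are pinned).
[cite: Teschl2012, Thm. 2.2] -/
theorem isInfBusSolutionOn_eq_of_eq_zero (hG : ∀ i j, i ≠ j → d.G i j = 0) {δ₀ : ℝ}
    {c c' : ℝ → ClassicalSwing.State (n + 1)} (hc : d.IsInfBusSolutionOn δ₀ c (Ici 0))
    (hc' : d.IsInfBusSolutionOn δ₀ c' (Ici 0)) (h0 : c 0 = c' 0) {t : ℝ} (ht : 0 ≤ t) : c t = c' t := by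
  have hX : ∀ T : ℝ, ∀ s ∈ Icc 0 T, HasDerivWithinAt (fun τ => machineProj (c τ))
      ((d.toLosslessInf δ₀).field (machineProj (c s))) (Icc 0 T) s :=
    fun T s hs => ((d.hasDerivWithinAt_machineProj hG hc) s hs.1).mono Icc_subset_Ici_self
  have hY : ∀ T : ℝ, ∀ s ∈ Icc 0 T, HasDerivWithinAt (fun τ => machineProj (c' τ))
      ((d.toLosslessInf δ₀).field (machineProj (c' s))) (Icc 0 T) s :=
    fun T s hs => ((d.hasDerivWithinAt_machineProj hG hc') s hs.1).mono Icc_subset_Ici_self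
  have h := (d.toLosslessInf δ₀).globalSolution_unique hX hY (by simp [h0]) ht
  rw [← busLift_machineProj (hc t ht).1 (hc t ht).2.1, ← busLift_machineProj (hc' t ht).1 (hc' t ht).2.1]
  exact congrArg (busLift δ₀) h

/-! ### ★ #93 with an infinite bus, on model-1's class -/

/-- **THE DICHOTOMY WITH AN INFINITE BUS (★ #93 §5 by name).** Lossless reciprocal data, machine inertias
and dampings `M_i, D_i > 0` (`i ≠ 0`): along EVERY infinite-bus solution `c` on `[0, ∞)` (bus at angle
`δ₀`) EITHER lit-6's printed energy of the machines-plus-bus system `→ −∞` and the injections' work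
`Σ_i P′_i δ_i(t) → +∞` — the machines lose synchronism WITH the bus, the angle vector leaves every bounded
set — OR the energy converges, every machine speed deviation `ω_i(t) → 0` and every power mismatch
`Pprime_i − P_e,i(δ(t)) → 0` (quasi-static). Which alternative holds is NOT claimed.
[cite: Chiang1995, §3 Thm 3.1; Leonov2001, Ch. 4 §4.2 Thm 4.1; VuTuritsyn2016, §III] -/
theorem infBus_dichotomy (hG : ∀ i j, i ≠ j → d.G i j = 0) (hB : ∀ i j, d.B i j = d.B j i)
    (hM : ∀ i : Fin n, 0 < d.M i.succ) (hD : ∀ i : Fin n, 0 < d.D i.succ) {δ₀ : ℝ}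
    {c : ℝ → ClassicalSwing.State (n + 1)} (hc : d.IsInfBusSolutionOn δ₀ c (Ici 0)) :
    (Tendsto (fun t => (d.toLosslessInf δ₀).energy (machineProj (c t))) atTop atBot ∧
        Tendsto (fun t => ∑ i : Fin n, ((d.Pprime i.succ - d.E i.succ ^ 2 * d.G i.succ i.succ : ℚ) : ℝ) *
          (c t).1 i.succ) atTop atTop) ∨
      ((∃ e : ℝ, Tendsto (fun t => (d.toLosslessInf δ₀).energy (machineProj (c t))) atTop (𝓝 e)) ∧
        (∀ i : Fin n, Tendsto (fun t => (c t).2 i.succ) atTop (𝓝 0)) ∧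
        ∀ i : Fin n, Tendsto (fun t => (d.Pprime i.succ : ℝ) - d.toModel.Pe (c t).1 i.succ) atTop (𝓝 0)) := by
  have hX : ∀ T : ℝ, ∀ s ∈ Icc 0 T, HasDerivWithinAt (fun τ => machineProj (c τ))
      ((d.toLosslessInf δ₀).field (machineProj (c s))) (Icc 0 T) s :=
    fun T s hs => ((d.hasDerivWithinAt_machineProj hG hc) s hs.1).mono Icc_subset_Ici_self
  have hM' : ∀ i, 0 < (d.toLosslessInf δ₀).M i := fun i => by
    show (0 : ℝ) < (d.M i.succ : ℝ); exact_mod_cast hM i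
  have hD' : ∀ i, 0 < (d.toLosslessInf δ₀).D i := fun i => by
    show (0 : ℝ) < (d.D i.succ : ℝ); exact_mod_cast hD i
  rcases (d.toLosslessInf δ₀).tendsto_energy_atBot_or_quasistatic (d.toLosslessInf_C_symm hB δ₀) hM' hD'
      hX with ⟨hbot, hwork⟩ | ⟨he, hω, hmis⟩
  · refine Or.inl ⟨hbot, ?_⟩
    refine hwork.congr fun t => Finset.sum_congr rfl fun i _ => ?_
    simp only [toLosslessInf, machineProj_fst]
    push_cast
    ring
  · refine Or.inr ⟨he, fun i => by simpa using hω i, fun i => ?_⟩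
    have hflow : ∀ t, 0 ≤ t → (d.toLosslessInf δ₀).flow (machineProj (c t)).1 i =
        d.toModel.Pe (c t).1 i.succ - (d.E i.succ : ℝ) ^ 2 * (d.G i.succ i.succ : ℝ) :=
      fun t ht => d.toLosslessInf_flow hG (hc t ht).1 i
    refine (hmis i).congr' ?_
    filter_upwards [eventually_ge_atTop 0] with t ht
    rw [hflow t ht]
    simp only [toLosslessInf]
    ring

/-- **Bounded machine angles ⇒ quasi-static (★ #93 §11 by name).** Same hypotheses: if along an
infinite-bus solution on `[0, ∞)` every machine angle stays bounded, `|δ_i(t)| ≤ B` for `t ≥ 0`, then the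
energy converges, every machine speed deviation `→ 0` and every mismatch `→ 0`.
[cite: Leonov2001, Ch. 4 §4.2 Thm 4.1; Chiang1995, §3 Thm 3.1] -/
theorem infBus_quasistatic_of_angles_bounded (hG : ∀ i j, i ≠ j → d.G i j = 0)
    (hB : ∀ i j, d.B i j = d.B j i) (hM : ∀ i : Fin n, 0 < d.M i.succ) (hD : ∀ i : Fin n, 0 < d.D i.succ)
    {δ₀ : ℝ} {c : ℝ → ClassicalSwing.State (n + 1)} (hc : d.IsInfBusSolutionOn δ₀ c (Ici 0)) {B : ℝ}
    (hbd : ∀ t, 0 ≤ t → ∀ i : Fin n, |(c t).1 i.succ| ≤ B) :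
    (∃ e : ℝ, Tendsto (fun t => (d.toLosslessInf δ₀).energy (machineProj (c t))) atTop (𝓝 e)) ∧
      (∀ i : Fin n, Tendsto (fun t => (c t).2 i.succ) atTop (𝓝 0)) ∧
      ∀ i : Fin n, Tendsto (fun t => (d.Pprime i.succ : ℝ) - d.toModel.Pe (c t).1 i.succ) atTop (𝓝 0) := by
  have hX : ∀ T : ℝ, ∀ s ∈ Icc 0 T, HasDerivWithinAt (fun τ => machineProj (c τ))
      ((d.toLosslessInf δ₀).field (machineProj (c s))) (Icc 0 T) s :=
    fun T s hs => ((d.hasDerivWithinAt_machineProj hG hc) s hs.1).mono Icc_subset_Ici_self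
  have hM' : ∀ i, 0 < (d.toLosslessInf δ₀).M i := fun i => by
    show (0 : ℝ) < (d.M i.succ : ℝ); exact_mod_cast hM i
  have hD' : ∀ i, 0 < (d.toLosslessInf δ₀).D i := fun i => by
    show (0 : ℝ) < (d.D i.succ : ℝ); exact_mod_cast hD i
  have hB' : ∀ t, 0 ≤ t → ‖(machineProj (c t)).1‖ ≤ max B 0 := by
    intro t ht
    refine (pi_norm_le_iff_of_nonneg (le_max_right _ _)).2 fun i => ?_
    rw [Real.norm_eq_abs, machineProj_fst]
    exact (hbd t ht i).trans (le_max_left _ _)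
  obtain ⟨he, hω, hmis⟩ := (d.toLosslessInf δ₀).quasistatic_of_angles_bounded
    (d.toLosslessInf_C_symm hB δ₀) hM' hD' hX hB'
  refine ⟨he, fun i => by simpa using hω i, fun i => ?_⟩
  have hflow : ∀ t, 0 ≤ t → (d.toLosslessInf δ₀).flow (machineProj (c t)).1 i =
      d.toModel.Pe (c t).1 i.succ - (d.E i.succ : ℝ) ^ 2 * (d.G i.succ i.succ : ℝ) :=
    fun t ht => d.toLosslessInf_flow hG (hc t ht).1 i
  refine (hmis i).congr' ?_
  filter_upwards [eventually_ge_atTop 0] with t ht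
  rw [hflow t ht]
  simp only [toLosslessInf]
  ring

end RecastData

/-! ### Instance CHIANG3 (2 machines + the reference bus, ★ G1.a′ object) -/

namespace Chiang3

open InfBus

/-- Chiang's three-bus cycle is lossless (`G = 0`). -/
theorem data_transferConductance_eq_zero : ∀ i j : Fin 3, i ≠ j → data.G i j = 0 := by decide +kernel

/-- The cycle's susceptances are reciprocal (the `hB` hypothesis of the generic lemmas). -/
theorem data_B_reciprocal (a b : Fin 3) : data.B b a = data.B a b := by revert a b; decide +kernel

/-- **CHIANG3, every infinite-bus motion: loss of synchronism with the bus OR quasi-static** (★ #93 §5 by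
name on model-1's typed object `Chiang3.data`, bus angle `δ₀` arbitrary): along every
`Chiang3.data.IsInfBusSolutionOn δ₀ c (Ici 0)` EITHER lit-6's energy `→ −∞` with `P′₁δ₁ + P′₂δ₂ → +∞` OR the
energy converges, `ω₁, ω₂ → 0` and both mismatches `P′_k − P_e,k(δ(t)) → 0`. MODELLED: MV-2L+MV-P (REDEFINED
injections `P′` at the A1 circle points), machines `M = 1`, `D = (2/5, 1/2)`; not a grid.
[cite: Chiang1995, §3 Thm 3.1, §4.1; Leonov2001, Ch. 4 §4.2 Thm 4.1] -/
theorem infBus_dichotomy {δ₀ : ℝ} {c : ℝ → ClassicalSwing.State 3}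
    (hc : data.IsInfBusSolutionOn δ₀ c (Ici 0)) :
    (Tendsto (fun t => (data.toLosslessInf δ₀).energy (machineProj (c t))) atTop atBot ∧
        Tendsto (fun t => ∑ i : Fin 2, ((data.Pprime i.succ - data.E i.succ ^ 2 * data.G i.succ i.succ : ℚ) : ℝ) *
          (c t).1 i.succ) atTop atTop) ∨
      ((∃ e : ℝ, Tendsto (fun t => (data.toLosslessInf δ₀).energy (machineProj (c t))) atTop (𝓝 e)) ∧
        (∀ i : Fin 2, Tendsto (fun t => (c t).2 i.succ) atTop (𝓝 0)) ∧
        ∀ i : Fin 2, Tendsto (fun t => (data.Pprime i.succ : ℝ) - data.toModel.Pe (c t).1 i.succ) atTop (𝓝 0)) :=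
  have hM : ∀ i : Fin 2, 0 < data.M i.succ := by decide +kernel
  have hD : ∀ i : Fin 2, 0 < data.D i.succ := by decide +kernel
  data.infBus_dichotomy data_transferConductance_eq_zero (fun a b => data_B_reciprocal b a) hM hD hc

/-- **CHIANG3, bounded machine angles ⇒ quasi-static** (★ #93 §11 by name): if along an infinite-bus motion
`|δ₁(t)|, |δ₂(t)| ≤ B` for `t ≥ 0`, then the energy converges, `ω₁, ω₂ → 0` and both mismatches `→ 0`.
[cite: Leonov2001, Ch. 4 §4.2 Thm 4.1; Chiang1995, §3 Thm 3.1] -/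
theorem infBus_quasistatic_of_angles_bounded {δ₀ : ℝ} {c : ℝ → ClassicalSwing.State 3}
    (hc : data.IsInfBusSolutionOn δ₀ c (Ici 0)) {B : ℝ} (hbd : ∀ t, 0 ≤ t → ∀ i : Fin 2, |(c t).1 i.succ| ≤ B) :
    (∃ e : ℝ, Tendsto (fun t => (data.toLosslessInf δ₀).energy (machineProj (c t))) atTop (𝓝 e)) ∧
      (∀ i : Fin 2, Tendsto (fun t => (c t).2 i.succ) atTop (𝓝 0)) ∧
      ∀ i : Fin 2, Tendsto (fun t => (data.Pprime i.succ : ℝ) - data.toModel.Pe (c t).1 i.succ) atTop (𝓝 0) :=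
  have hM : ∀ i : Fin 2, 0 < data.M i.succ := by decide +kernel
  have hD : ∀ i : Fin 2, 0 < data.D i.succ := by decide +kernel
  data.infBus_quasistatic_of_angles_bounded data_transferConductance_eq_zero (fun a b => data_B_reciprocal b a)
    hM hD hc hbd

/-- **CHIANG3, CLASS = all admissible states**: from every state with the bus at `(δ₀, 0)` a GLOBAL
infinite-bus motion exists, and two such motions on `[0, ∞)` with the same initial state agree for all
`t ≥ 0`. [cite: Teschl2012, Thm. 2.2 and Cor. 2.6] -/
theorem exists_infBus_motion {δ₀ : ℝ} {x₀ : ClassicalSwing.State 3} (h1 : x₀.1 0 = δ₀) (h2 : x₀.2 0 = 0) :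
    (∃ c : ℝ → ClassicalSwing.State 3, c 0 = x₀ ∧ data.IsInfBusSolutionOn δ₀ c univ) ∧
      ∀ c c' : ℝ → ClassicalSwing.State 3, data.IsInfBusSolutionOn δ₀ c (Ici 0) →
        data.IsInfBusSolutionOn δ₀ c' (Ici 0) → c 0 = x₀ → c' 0 = x₀ → ∀ t, 0 ≤ t → c t = c' t :=
  ⟨data.exists_isInfBusSolutionOn_univ data_transferConductance_eq_zero h1 h2,
    fun _ _ hc hc' h0 h0' _ ht => data.isInfBusSolutionOn_eq_of_eq_zero
      data_transferConductance_eq_zero hc hc' (h0.trans h0'.symm) ht⟩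

end Chiang3

end Summit.Ventures.GridStability.Models
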